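import Summits.NavierStokesRegularity.NavierStokesRegularity.Theorems.HubbleDynamoNoSelfExcitedDynamoStubEnstrophyBalance
import Literature.Analysis.FluidPDE.SobolevWholeSpace
import HarnessLib

/-!
# Crux `HubbleDynamo.NoSelfExcitedDynamo` (stmt-NavierStokesRegularity-1934), line `registered`:
# stub `stub_stretchSobolev` — the Sobolev stretching bound `S⁴ ≤ K_S⁶ (∫|DV|²_F)² E D_F³`

Helper file (`--supports stmt-NavierStokesRegularity-1934`; theorems only, sorry-free). For a `C³`
field `V : ℝ³ → ℝ³` in the profile (Type-I decay) class — one constant `K ≥ 0` with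
`(1+|y|)|V| ≤ K`, `(1+|y|)²‖DV‖ ≤ K`, `(1+|y|)³‖DΩ‖ ≤ K`, `(1+|y|)⁴|ΔΩ| ≤ K` (`Ω = curl V`) — the
vortex-stretching integral `S = ∫⟪Ω, (DV)Ω⟫` obeys

  `S⁴ ≤ K_S⁶ · (∫|DV|²_F)² · (∫‖Ω‖²) · (∫|DΩ|²_F)³`   (`stub_stretchSobolev`),

`K_S = SNormLESNormFDerivOfEqConst ℝ³ volume 2` Mathlib's Gagliardo–Nirenberg–Sobolev constant of
`‖u‖_{L⁶(ℝ³)} ≤ K_S ‖Du‖_{L²(ℝ³)}`. This is the polynomial form of `|S| ≤ K_S^{3/2} E^{3/4} D_F^{3/4}`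
(with `∫|DV|²_F = E` for divergence-free `V`, a sibling stub), the quantitative input of the
enstrophy floor of the line.

Proof. Every density is `O((1+|y|)⁻⁴)` and continuous, hence integrable
(`enstrophy_slice_integrable`, `hubbleDilution_integrable_of_le`). Pointwise
`|⟪Ω,(DV)Ω⟫| ≤ ‖DV‖ ‖Ω‖²`, so Cauchy–Schwarz (`integral_mul_le_sqrt_mul_sqrt_of_memLp`) gives
`|S| ≤ (∫‖DV‖²)^{1/2} (∫‖Ω‖⁴)^{1/2}`; the whole-space `L⁴` interpolation–Sobolev bound
`∫‖Ω‖⁴ ≤ K_S³ (∫‖Ω‖²)^{1/2} (∫‖DΩ‖²)^{3/2}` (`PineauVicol2026.memLp_four_and_integral_norm_pow_four_le`,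
from `‖Ω‖₄ ≤ ‖Ω‖₂^{1/4}‖Ω‖₆^{3/4}` and `‖Ω‖₆ ≤ K_S‖DΩ‖₂`, the tree's
`eLpNorm_six_le_eLpNorm_fderiv_two`, legitimate as `Ω ∈ C¹ ∩ L²`); finally `‖L‖² ≤ |L|²_F`
(`norm_sq_le_frobeniusNormSq`) for `L = DV` and `L = DΩ`, and real arithmetic
(`stretchSobolev_algebra`).

## References

* L. C. Evans, *Partial Differential Equations*, 2nd ed., AMS (2010), §5.6.1, Thm. 1–2
  (Gagliardo–Nirenberg–Sobolev inequality, `H¹(ℝ³) ⊂ L⁶(ℝ³)`). [Evans2010]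
* J. Leray, *Sur le mouvement d'un liquide visqueux emplissant l'espace*, Acta Math. 63 (1934)
  193–248, §20 (the self-similar profile system; the enstrophy blow-up rate). [Leray1934]
-/

noncomputable section

-- the registered stub namespace repeats the summit name `NavierStokesRegularity` (summit = problem)
set_option linter.dupNamespace false

namespace Summit.NavierStokesRegularity.NavierStokesRegularity.Theorems.NoSelfExcitedDynamo.Registered

open Set MeasureTheory Filter Topology InnerProductSpace Function
open scoped RealInnerProductSpace Laplacian ContDiff NNReal ENNReal
open Literature.Analysis.FluidPDE

/-! ### Real arithmetic of the chain of inequalities -/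

/-- The real arithmetic of the stretching bound: from `|S| ≤ P`, `P ≤ √A √Q` (Cauchy–Schwarz),
`Q ≤ k³ √E (√D)³` (`L⁴` interpolation and Sobolev), `A ≤ G`, `D ≤ F` (operator norm versus
Frobenius norm) and the signs, `S⁴ ≤ k⁶ G² E F³`. -/
theorem stretchSobolev_algebra {S P A Q G E D F k : ℝ} (hS : |S| ≤ P)
    (hP : P ≤ Real.sqrt A * Real.sqrt Q) (hQ : Q ≤ k ^ 3 * Real.sqrt E * Real.sqrt D ^ 3)
    (hA : A ≤ G) (hD : D ≤ F) (hA0 : 0 ≤ A) (hQ0 : 0 ≤ Q) (hE0 : 0 ≤ E) (hD0 : 0 ≤ D)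
    (hk : 0 ≤ k) : S ^ 4 ≤ k ^ 6 * G ^ 2 * E * F ^ 3 := by
  have hP0 : 0 ≤ P := (abs_nonneg S).trans hS
  have h1 : S ^ 4 ≤ A ^ 2 * Q ^ 2 :=
    calc S ^ 4 = (|S| ^ 2) ^ 2 := by rw [sq_abs]; ring
      _ ≤ (P ^ 2) ^ 2 := pow_le_pow_left₀ (sq_nonneg _) (pow_le_pow_left₀ (abs_nonneg _) hS 2) 2
      _ ≤ ((Real.sqrt A * Real.sqrt Q) ^ 2) ^ 2 :=
          pow_le_pow_left₀ (sq_nonneg _) (pow_le_pow_left₀ hP0 hP 2) 2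
      _ = (Real.sqrt A ^ 2) ^ 2 * (Real.sqrt Q ^ 2) ^ 2 := by ring
      _ = A ^ 2 * Q ^ 2 := by rw [Real.sq_sqrt hA0, Real.sq_sqrt hQ0]
  have h2 : Q ^ 2 ≤ k ^ 6 * E * D ^ 3 :=
    calc Q ^ 2 ≤ (k ^ 3 * Real.sqrt E * Real.sqrt D ^ 3) ^ 2 := pow_le_pow_left₀ hQ0 hQ 2
      _ = (k ^ 3) ^ 2 * Real.sqrt E ^ 2 * (Real.sqrt D ^ 2) ^ 3 := by ring
      _ = k ^ 6 * E * D ^ 3 := by rw [Real.sq_sqrt hE0, Real.sq_sqrt hD0]; ring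
  calc S ^ 4 ≤ A ^ 2 * Q ^ 2 := h1
    _ ≤ G ^ 2 * (k ^ 6 * E * D ^ 3) :=
        mul_le_mul (pow_le_pow_left₀ hA0 hA 2) h2 (sq_nonneg _) (sq_nonneg _)
    _ ≤ G ^ 2 * (k ^ 6 * E * F ^ 3) :=
        mul_le_mul_of_nonneg_left (mul_le_mul_of_nonneg_left (pow_le_pow_left₀ hD0 hD 3)
          (mul_nonneg (pow_nonneg hk 6) hE0)) (sq_nonneg _)
    _ = k ^ 6 * G ^ 2 * E * F ^ 3 := by ring

/-! ### Integrability of the densities in the profile class -/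

/-- In the profile class (`V ∈ C³` with the four profile bounds, `Ω = curl V`): `‖DV‖²`,
`|DV|²_F`, `‖Ω‖⁴ = (‖Ω‖²)²` and `‖DV‖ ‖Ω‖²` are integrable on `ℝ³` (all continuous and
`O((1+|y|)⁻⁴)`, `hubbleDilution_integrable_of_le`). -/
theorem stretchSobolev_integrable {V : EuclideanSpace ℝ (Fin 3) → EuclideanSpace ℝ (Fin 3)}
    (hV3 : ContDiff ℝ 3 V) {K : ℝ} (hK0 : 0 ≤ K)
    (hK : ∀ y, (1 + ‖y‖) * ‖V y‖ ≤ K ∧ (1 + ‖y‖) ^ 2 * ‖fderiv ℝ V y‖ ≤ K ∧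
      (1 + ‖y‖) ^ 3 * ‖fderiv ℝ (curl V) y‖ ≤ K ∧ (1 + ‖y‖) ^ 4 * ‖(Δ (curl V)) y‖ ≤ K) :
    Integrable (fun y => ‖fderiv ℝ V y‖ ^ 2) ∧
    Integrable (fun y => frobeniusNormSq (fderiv ℝ V y)) ∧
    Integrable (fun y => (‖curl V y‖ ^ 2) ^ 2) ∧
    Integrable (fun y => ‖fderiv ℝ V y‖ * ‖curl V y‖ ^ 2) := by
  have hV1 : ContDiff ℝ 1 V := hV3.of_le (by norm_cast)
  have hΩ1 : ContDiff ℝ 1 (curl V) := (PineauVicol2026.contDiff_two_curl hV3).of_le one_le_two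
  have cΩ : Continuous (curl V) := hΩ1.continuous
  have cDV : Continuous (fderiv ℝ V) := hV1.continuous_fderiv one_ne_zero
  obtain ⟨-, -, -, -, -, -, -, hΩsq⟩ := enstrophy_slice_integrable hV3 hK0 hK
  have hr1 : ∀ y : EuclideanSpace ℝ (Fin 3), (1 : ℝ) ≤ 1 + ‖y‖ := fun y => by
    linarith [norm_nonneg y]
  -- `‖DV‖ ≤ K`, `‖DV‖² ≤ K² (1+|y|)⁻⁴`, `‖Ω‖² ≤ (κK)²`
  have hDVK : ∀ y, ‖fderiv ℝ V y‖ ≤ K := fun y =>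
    (le_mul_of_one_le_left (norm_nonneg _) (one_le_pow₀ (hr1 y))).trans (hK y).2.1
  have hDVsq : ∀ y, ‖fderiv ℝ V y‖ ^ 2 ≤ K ^ 2 * ((1 + ‖y‖) ^ 4)⁻¹ := fun y => by
    rw [← div_eq_mul_inv, le_div_iff₀ (by positivity)]
    calc ‖fderiv ℝ V y‖ ^ 2 * (1 + ‖y‖) ^ 4 = ((1 + ‖y‖) ^ 2 * ‖fderiv ℝ V y‖) ^ 2 := by ring
      _ ≤ K ^ 2 := pow_le_pow_left₀ (by positivity) (hK y).2.1 2
  have hΩK : ∀ y, ‖curl V y‖ ^ 2 ≤ (‖curlCLM‖ * K) ^ 2 := fun y =>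
    (hΩsq y).trans (mul_le_of_le_one_right (sq_nonneg _)
      (inv_le_one_of_one_le₀ (one_le_pow₀ (hr1 y))))
  refine ⟨?_, ?_, ?_, ?_⟩
  · exact hubbleDilution_integrable_of_le (K := K ^ 2) (k := 4) (cDV.norm.pow 2) le_rfl fun y => by
      rw [Real.norm_of_nonneg (sq_nonneg _)]
      exact hDVsq y
  · refine hubbleDilution_integrable_of_le (K := 3 * K ^ 2) (k := 4)
      (continuous_frobeniusNormSq_fderiv hV1 one_ne_zero) le_rfl fun y => ?_
    rw [Real.norm_of_nonneg (frobeniusNormSq_nonneg _), mul_assoc]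
    exact (hubbleDilution_frobeniusNormSq_le _).trans
      (mul_le_mul_of_nonneg_left (hDVsq y) (by norm_num))
  · refine hubbleDilution_integrable_of_le (K := (‖curlCLM‖ * K) ^ 2 * (‖curlCLM‖ * K) ^ 2)
      (k := 4) ((cΩ.norm.pow 2).pow 2) le_rfl fun y => ?_
    rw [Real.norm_of_nonneg (by positivity), pow_two (‖curl V y‖ ^ 2), mul_assoc]
    exact mul_le_mul (hΩK y) (hΩsq y) (by positivity) (by positivity)
  · refine hubbleDilution_integrable_of_le (K := K * (‖curlCLM‖ * K) ^ 2) (k := 4)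
      (cDV.norm.mul (cΩ.norm.pow 2)) le_rfl fun y => ?_
    rw [Real.norm_of_nonneg (by positivity), mul_assoc]
    exact mul_le_mul (hDVK y) (hΩsq y) (by positivity) hK0

/-! ### The stub -/

/-- **stub T2 — `stub_stretchSobolev`.** The Sobolev stretching bound in the profile class: for a
`C³` field `V` on `ℝ³` with the four profile bounds (`Ω = curl V`) `(1+|y|)|V| ≤ K`,
`(1+|y|)²‖DV‖ ≤ K`, `(1+|y|)³‖DΩ‖ ≤ K`, `(1+|y|)⁴|ΔΩ| ≤ K`, the stretching integral
`S = ∫⟪Ω, (DV)Ω⟫` obeys `S⁴ ≤ K_S⁶ · (∫|DV|²_F)² · (∫‖Ω‖²) · (∫|DΩ|²_F)³`,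
`K_S = SNormLESNormFDerivOfEqConst ℝ³ volume 2` Mathlib's Gagliardo–Nirenberg–Sobolev constant:
`|⟪Ω,(DV)Ω⟫| ≤ ‖DV‖ ‖Ω‖²`, Cauchy–Schwarz `S² ≤ (∫‖DV‖²)(∫‖Ω‖⁴)`, the `L⁴` bound
`∫‖Ω‖⁴ ≤ K_S³ (∫‖Ω‖²)^{1/2} (∫‖DΩ‖²)^{3/2}` (interpolation and the whole-space Sobolev
inequality `‖Ω‖₆ ≤ K_S ‖DΩ‖₂`, `Ω ∈ C¹ ∩ L²`), and `‖L‖² ≤ |L|²_F`. -/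
theorem stub_stretchSobolev :
    ∀ (V : EuclideanSpace ℝ (Fin 3) → EuclideanSpace ℝ (Fin 3)) (K : ℝ), ContDiff ℝ 3 V → 0 ≤ K →
      (∀ y, (1 + ‖y‖) * ‖V y‖ ≤ K ∧ (1 + ‖y‖) ^ 2 * ‖fderiv ℝ V y‖ ≤ K ∧
        (1 + ‖y‖) ^ 3 * ‖fderiv ℝ (curl V) y‖ ≤ K ∧ (1 + ‖y‖) ^ 4 * ‖(Δ (curl V)) y‖ ≤ K) →
      (∫ y, ⟪curl V y, fderiv ℝ V y (curl V y)⟫) ^ 4 ≤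
        ((SNormLESNormFDerivOfEqConst (EuclideanSpace ℝ (Fin 3))
            (volume : Measure (EuclideanSpace ℝ (Fin 3))) 2 : ℝ≥0) : ℝ) ^ 6 *
          (∫ y, frobeniusNormSq (fderiv ℝ V y)) ^ 2 * (∫ y, ‖curl V y‖ ^ 2) *
          (∫ y, frobeniusNormSq (fderiv ℝ (curl V) y)) ^ 3 := by
  intro V K hV3 hK0 hK
  -- regularity
  have hV1 : ContDiff ℝ 1 V := hV3.of_le (by norm_cast)
  have hΩ1 : ContDiff ℝ 1 (curl V) := (PineauVicol2026.contDiff_two_curl hV3).of_le one_le_two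
  have cΩ : Continuous (curl V) := hΩ1.continuous
  have cDΩ : Continuous (fderiv ℝ (curl V)) := hΩ1.continuous_fderiv one_ne_zero
  have cDV : Continuous (fderiv ℝ V) := hV1.continuous_fderiv one_ne_zero
  -- integrability of every density
  obtain ⟨iE, iDF, iS, -, iD2, -⟩ := enstrophy_slice_integrable hV3 hK0 hK
  obtain ⟨iA, iG, iQ, iP⟩ := stretchSobolev_integrable hV3 hK0 hK
  -- `L²` memberships
  have mΩ : MemLp (curl V) 2 volume :=
    (memLp_two_iff_integrable_sq_norm cΩ.aestronglyMeasurable).2 iE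
  have mDΩ : MemLp (fderiv ℝ (curl V)) 2 volume :=
    (memLp_two_iff_integrable_sq_norm cDΩ.aestronglyMeasurable).2 iD2
  have mDV : MemLp (fun y => ‖fderiv ℝ V y‖) 2 volume :=
    (memLp_two_iff_integrable_sq cDV.norm.aestronglyMeasurable).2 iA
  have mΩ2 : MemLp (fun y => ‖curl V y‖ ^ 2) 2 volume :=
    (memLp_two_iff_integrable_sq (cΩ.norm.pow 2).aestronglyMeasurable).2 iQ
  -- (1) `|S| ≤ ∫ ‖DV‖ ‖Ω‖²`
  have hS : |∫ y, ⟪curl V y, fderiv ℝ V y (curl V y)⟫| ≤ ∫ y, ‖fderiv ℝ V y‖ * ‖curl V y‖ ^ 2 := by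
    refine abs_integral_le_integral_abs.trans (integral_mono iS.abs iP fun y => ?_)
    calc |⟪curl V y, fderiv ℝ V y (curl V y)⟫| ≤ ‖curl V y‖ * ‖fderiv ℝ V y (curl V y)‖ :=
          abs_real_inner_le_norm _ _
      _ ≤ ‖curl V y‖ * (‖fderiv ℝ V y‖ * ‖curl V y‖) :=
          mul_le_mul_of_nonneg_left ((fderiv ℝ V y).le_opNorm _) (norm_nonneg _)
      _ = ‖fderiv ℝ V y‖ * ‖curl V y‖ ^ 2 := by ring
  -- (2) Cauchy–Schwarz `∫ ‖DV‖ ‖Ω‖² ≤ (∫‖DV‖²)^{1/2} (∫‖Ω‖⁴)^{1/2}`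
  have hP : ∫ y, ‖fderiv ℝ V y‖ * ‖curl V y‖ ^ 2 ≤
      Real.sqrt (∫ y, ‖fderiv ℝ V y‖ ^ 2) * Real.sqrt (∫ y, (‖curl V y‖ ^ 2) ^ 2) :=
    integral_mul_le_sqrt_mul_sqrt_of_memLp mDV mΩ2
  have hQeq : ∫ y, (‖curl V y‖ ^ 2) ^ 2 = ∫ y, ‖curl V y‖ ^ 4 :=
    integral_congr_ae (Eventually.of_forall fun y => by ring)
  rw [hQeq] at hP
  -- (3) `L⁴` interpolation and Sobolev `∫‖Ω‖⁴ ≤ K_S³ (∫‖Ω‖²)^{1/2} (∫‖DΩ‖²)^{3/2}`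
  have hQ := (PineauVicol2026.memLp_four_and_integral_norm_pow_four_le hΩ1 mΩ mDΩ).2
  -- (4) operator norm versus Frobenius norm
  have hA : ∫ y, ‖fderiv ℝ V y‖ ^ 2 ≤ ∫ y, frobeniusNormSq (fderiv ℝ V y) :=
    integral_mono iA iG fun y => norm_sq_le_frobeniusNormSq _
  have hD : ∫ y, ‖fderiv ℝ (curl V) y‖ ^ 2 ≤ ∫ y, frobeniusNormSq (fderiv ℝ (curl V) y) :=
    integral_mono iD2 iDF fun y => norm_sq_le_frobeniusNormSq _
  exact stretchSobolev_algebra hS hP hQ hA hD (integral_nonneg fun _ => sq_nonneg _)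
    (integral_nonneg fun _ => by positivity) (integral_nonneg fun _ => sq_nonneg _)
    (integral_nonneg fun _ => sq_nonneg _) (NNReal.coe_nonneg _)

end Summit.NavierStokesRegularity.NavierStokesRegularity.Theorems.NoSelfExcitedDynamo.Registered

end
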